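import Mathlib
import Summits.NavierStokesRegularity.NavierStokesRegularity.Theorems.TaoLadderRungTwoBreakBlowupRigidityOneSubcriticalCeiling
import Summits.NavierStokesRegularity.NavierStokesRegularity.Theorems.TaoLadderRungTwoBreakBlowupRigidityOneRenormalisedFlow
import HarnessLib

/-!
# The viscous companions of a robust blow-up are (S_a)-surviving forward for EVERY `a > 1` — the survival
  half of `stub_eternalFromBlowup` (K2(1) `TaoLadderRungTwoBreak.BlowupRigidityOne`, stmt-NavierStokesRegularity-20206)
  at every exponent above the registered `a = 1`, for the renormalised `ν̂`-viscous blow-ups (`ν̂ > 0`)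

MODEL lattice ODEs only (Tao 2016 §4: the NS-scaled viscous lattice before Theorem 4.2, Lemma 4.1 (4.5), §6.4);
nothing here is a statement about the Navier–Stokes equations; NO item is closed (`--supports
stmt-NavierStokesRegularity-20206`). Route-independent, general `m`, DEF-FREE. Sequel of `…SubcriticalCeiling`
(`weight45_bounded_of_subcriticalCeiling`: a sub-(S₁) geometric amplitude ceiling keeps a viscous flow regular).

* `weightedEnergy_small_early_base` — (4.5)-regularity before `T` makes `w^n ‖x_n(t)‖²` small on `[0,T']`, `T' < T`,
  for large `n`, for every base `0 ≤ w < (1+ε₀)^{20}` (the `w = 1+ε₀` case is `weightedEnergy_small_early`);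
* `renormalisedFlow_weightedEnergy_rpow` — `physWeight(a)^n · e^{2σ}‖W_n(σ)‖² = ((1+ε₀)^a)^n ‖x_n(T - e^{-σ})‖²`
  for every real `a` (the `a = 1` case is `renormalisedFlow_weightedEnergy`);
* `viscousFloors_of_noGlobalCascade` — ROBUST BLOW-UP ⇒ for every `0 < ν̂ ≤ κ/√2` the maximal `ν̂`-viscous flow exceeds
  every sub-(S₁) envelope `B ν^j` (`(1+ε₀)ν² < 1`) ON ARBITRARILY HIGH SHELLS: `∀ J, ∃ j ≥ J, ∃ t < T, B ν^j < ‖x_j(t)‖`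
  (the low shells are absorbed into `B` by the energy bound `‖x_j‖ ≤ √m ‖X₀‖`);
* `eternalSurvivingFwd_viscous_of_one_lt` — **ROBUST BLOW-UP ⇒ every renormalised viscous companion
  `W_n(σ) = Λ^n e^{-σ} x_n(T - e^{-σ})` is `EternalSurvivingFwd a ε₀ W` for EVERY `a > 1`**: with `w = (1+ε₀)^{a'}`,
  `a' = min a 2`, `ν = w^{-1/2}` the floors `‖x_n(t_n)‖ > ν^n` give `w^n‖x_n(t_n)‖² > 1` on infinitely many shells, the
  times `t_n` are late by `weightedEnergy_small_early_base`, and survival is antitone in `a` (`EternalSurvivingFwd.mono`).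

POSITION against the item. The registered stub asks for an admissible ETERNAL INVISCID `W` with `EternalSurvivingFwd 1`;
the lineage has `a = 5` unconditionally for the renormalised exact flow (`eternalSurvivingFwd_five_of_noGlobalCascade`,
p822127). Here: every `a > 1`, for every positive viscosity `ν̂ ≤ κ/√2`, for the renormalised viscous blow-up on its
half-line (law of `IsEternalVisc` for `e^{-σ} < T`, `viscousBlowupProfile_of_noGlobalCascade`) — four of the five powers of
`1+ε₀` per shell recovered, by the dissipation mechanism the cell's heuristic (S) predicted; the endpoint `a = 1`, the
inviscid flow and the ω-limit (two-sided `IsEternal`) remain open. HONEST LABEL: no stub, crux or summit is proved; rung 0.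
-/

noncomputable section

-- the summit and its single sub-problem share the name (CONVENTIONS §1)
set_option linter.dupNamespace false

open Set Filter Topology

namespace Summit.NavierStokesRegularity.NavierStokesRegularity.Theorems

namespace BlowupRigidityOne

open Literature.Analysis.FluidPDE Literature.Analysis.FluidPDE.TaoCascade

variable {m : ℕ}

/-- **Early on, high shells are small at any weight below `(1+ε₀)^{20}`.** Under (4.5)-regularity on every `[0,T']`,
`0 < T' < T`: for `c > 0` and `0 ≤ w < (1+ε₀)^{20}` there is `K` with `w^n ‖x_n(t)‖² < c` for all `n ≥ K`, `t ∈ [0,T']`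
(`‖x_n(t)‖ ≤ √m · M(T') · (1+ε₀)^{-10n}` there). [cite: Tao2016AveragedNS, §4 Lemma 4.1 (4.5)] -/
theorem weightedEnergy_small_early_base {ε₀ T : ℝ} (hε : 0 < ε₀) {X : Fin m → ℤ → ℝ → ℝ}
    (hreg : ∀ T' : ℝ, 0 < T' → T' < T → ∃ M : ℝ, ∀ t : ℝ, 0 ≤ t → t ≤ T' →
      ∀ (i : Fin m) (n : ℤ), (1 + (1 + ε₀) ^ ((10 : ℝ) * n)) * |X i n t| ≤ M)
    {T' c w : ℝ} (hT'0 : 0 < T') (hT' : T' < T) (hc : 0 < c) (hw0 : 0 ≤ w) (hw : w < (1 + ε₀) ^ 20) :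
    ∃ K : ℕ, ∀ n : ℕ, K ≤ n → ∀ t : ℝ, 0 ≤ t → t ≤ T' → w ^ n * ‖shellVec X (n : ℤ) t‖ ^ 2 < c := by
  have hb : (0 : ℝ) < 1 + ε₀ := by linarith
  obtain ⟨M, hM⟩ := hreg T' hT'0 hT'
  have hcomp : ∀ (n : ℕ) (t : ℝ), 0 ≤ t → t ≤ T' → ∀ i : Fin m,
      |X i (n : ℤ) t| ≤ |M| * (((1 + ε₀) ^ 10) ^ n)⁻¹ := by
    intro n t ht0 ht1 i
    have h := hM t ht0 ht1 i (n : ℤ)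
    have h10 : (1 + ε₀) ^ ((10 : ℝ) * ((n : ℤ) : ℝ)) = ((1 + ε₀) ^ 10) ^ n := by
      rw [show (10 : ℝ) * ((n : ℤ) : ℝ) = ((10 * n : ℕ) : ℝ) by push_cast; ring, Real.rpow_natCast, pow_mul]
    rw [h10] at h
    have hpos : 0 < ((1 + ε₀) ^ 10) ^ n := by positivity
    rw [← div_eq_mul_inv, le_div_iff₀ hpos]
    calc |X i (n : ℤ) t| * ((1 + ε₀) ^ 10) ^ n ≤ (1 + ((1 + ε₀) ^ 10) ^ n) * |X i (n : ℤ) t| := by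
          nlinarith [abs_nonneg (X i (n : ℤ) t)]
      _ ≤ M := h
      _ ≤ |M| := le_abs_self M
  set r : ℝ := w / (1 + ε₀) ^ 20 with hr
  have h20 : 0 < (1 + ε₀) ^ 20 := by positivity
  have hr0 : 0 ≤ r := by positivity
  have hr1 : r < 1 := by rw [hr, div_lt_one h20]; exact hw
  set A : ℝ := (m : ℝ) * |M| ^ 2 + 1 with hA
  have hA0 : 0 < A := by positivity
  obtain ⟨K, hK⟩ := exists_pow_lt_of_lt_one (div_pos hc hA0) hr1
  refine ⟨K, fun n hn t ht0 ht1 => ?_⟩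
  have hnorm := DSSOneShift.norm_shellVec_le_sqrt_mul (by positivity) (hcomp n t ht0 ht1)
  have hrn : r ^ n ≤ r ^ K := pow_le_pow_of_le_one hr0 hr1.le hn
  have hq : w ^ n * (Real.sqrt m * (|M| * (((1 + ε₀) ^ 10) ^ n)⁻¹)) ^ 2 = (m : ℝ) * |M| ^ 2 * r ^ n := by
    have hpow : ((1 + ε₀) ^ 20) ^ n = (((1 + ε₀) ^ 10) ^ n) ^ 2 := by
      rw [← pow_mul, ← pow_mul, ← pow_mul]; ring_nf
    rw [hr, div_pow, mul_pow, Real.sq_sqrt (Nat.cast_nonneg m), mul_pow, inv_pow, hpow, div_eq_mul_inv]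
    ring
  calc w ^ n * ‖shellVec X (n : ℤ) t‖ ^ 2
      ≤ w ^ n * (Real.sqrt m * (|M| * (((1 + ε₀) ^ 10) ^ n)⁻¹)) ^ 2 :=
        mul_le_mul_of_nonneg_left (pow_le_pow_left₀ (norm_nonneg _) hnorm 2) (pow_nonneg hw0 n)
    _ = (m : ℝ) * |M| ^ 2 * r ^ n := hq
    _ ≤ A * r ^ K := mul_le_mul (by rw [hA]; linarith) hrn (pow_nonneg hr0 n) hA0.le
    _ < A * (c / A) := mul_lt_mul_of_pos_left hK hA0
    _ = c := mul_div_cancel₀ c hA0.ne'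

/-- **The `a`-weighted renormalised energy is the physical `(1+ε₀)^{an}`-weighted shell energy**, for every real `a`:
`physWeight(a)^n · e^{2σ}‖W_n(σ)‖² = ((1+ε₀)^a)^n ‖x_n(T - e^{-σ})‖²` (`W_n(σ) = Λ^n e^{-σ} x_n(T - e^{-σ})`, shells `n ∈ ℕ`).
[cite: Tao2016AveragedNS, §6.4 and §4 (4.1); cell vocabulary (`physWeight`, `EternalSurvivingFwd`)] -/
theorem renormalisedFlow_weightedEnergy_rpow {ε₀ T : ℝ} (hε : 0 < ε₀) {X : Fin m → ℤ → ℝ → ℝ}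
    {W : ℤ → ℝ → Em m}
    (hW : ∀ n σ, W n σ = (bigLam ε₀ ^ n * Real.exp (-σ)) • shellVec X n (T - Real.exp (-σ)))
    (a : ℝ) (n : ℕ) (σ : ℝ) :
    physWeight a ε₀ ^ n * (Real.exp (2 * σ) * ‖W n σ‖ ^ 2) =
      ((1 + ε₀) ^ a) ^ n * ‖shellVec X n (T - Real.exp (-σ))‖ ^ 2 := by
  have hb : (0 : ℝ) < 1 + ε₀ := by linarith
  have hexp : Real.exp (2 * σ) * Real.exp (-σ) ^ 2 = 1 := by
    rw [sq, ← Real.exp_add, ← Real.exp_add, show 2 * σ + (-σ + -σ) = 0 by ring, Real.exp_zero]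
  have h5 : (1 + ε₀) ^ (5 * n) ≠ 0 := pow_ne_zero _ hb.ne'
  have key : physWeight a ε₀ ^ n * (Real.exp (2 * σ) * ‖W n σ‖ ^ 2) =
      ((1 + ε₀) ^ a) ^ n * ‖shellVec X n (T - Real.exp (-σ))‖ ^ 2 *
        ((Real.exp (2 * σ) * Real.exp (-σ) ^ 2) * ((1 + ε₀) ^ (5 * n) / (1 + ε₀) ^ (5 * n))) := by
    unfold physWeight
    rw [renormalisedFlow_norm hε hW, zpow_natCast, div_pow, mul_pow, mul_pow, bigLam_pow_sq hε.le n, ← pow_mul]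
    ring
  rw [key, hexp, div_self h5, mul_one, mul_one]

/-- **ROBUST BLOW-UP ⇒ FLOORS ABOVE EVERY SUB-(S₁) RATE ON ARBITRARILY HIGH SHELLS OF EVERY VISCOUS COMPANION.**
If `NoGlobalCascade ε₀ α X₀` (`ε₀ > 0`, `α ∈ E₂(R)`, any `m`), there is `κ > 0` such that for every viscosity
`0 < ν̂ ≤ κ/√2` the maximal `ν̂`-viscous flow from the one-shell datum (`C¹` on `[0,T)`, datum, no shells below `0`, viscous
motion, (4.5)-regular before `T`, (4.5) norm unbounded on `[0,T)`) satisfies: for all `B`, all `0 < ν` with `(1+ε₀)ν² < 1`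
and all `J`, some shell `j ≥ J` and time `t ∈ [0,T)` have `B ν^j < ‖x_j(t)‖`. (Below `J` the energy bound `‖x_j‖ ≤ √m‖X₀‖`
lets the envelope be enlarged; above `J` a ceiling would make the flow regular by `weight45_bounded_of_subcriticalCeiling`.)
[cite: Tao2016AveragedNS, §4 Thm. 4.2, the viscous equation before Thm. 4.2, Lemma 4.1 (4.5); Teschl2012, §2.6 Cor. 2.16] -/
theorem viscousFloors_of_noGlobalCascade {ε₀ R : ℝ} (hε : 0 < ε₀)
    {α : Fin m → Fin m → Fin m → ℤ × ℤ × ℤ → ℝ} {X₀ : Fin m → ℝ} (hα : InTableClass R α)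
    (hNG : NoGlobalCascade ε₀ α X₀) :
    ∃ κ : ℝ, 0 < κ ∧ ∀ visc : ℝ, 0 < visc → visc * Real.sqrt 2 ≤ κ →
      ∃ (T : ℝ) (X : Fin m → ℤ → ℝ → ℝ), 0 < T ∧
        (∀ i n, ContDiffOn ℝ 1 (X i n) (Set.Ico 0 T)) ∧
        (∀ i n, X i n 0 = if n = 0 then X₀ i else 0) ∧
        (∀ i n t, n < 0 → X i n t = 0) ∧
        (∀ i n t, 0 ≤ t → t < T → derivWithin (X i n) (Set.Ici 0) t =
          quadTerm ε₀ α X i n t - visc * (1 + ε₀) ^ ((2 : ℝ) * n) * X i n t) ∧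
        (∀ T' : ℝ, 0 < T' → T' < T → ∃ M : ℝ, ∀ t : ℝ, 0 ≤ t → t ≤ T' →
          ∀ (i : Fin m) (n : ℤ), (1 + (1 + ε₀) ^ ((10 : ℝ) * n)) * |X i n t| ≤ M) ∧
        (∀ M : ℝ, ∃ t : ℝ, 0 ≤ t ∧ t < T ∧
          ∃ (i : Fin m) (n : ℤ), M < (1 + (1 + ε₀) ^ ((10 : ℝ) * n)) * |X i n t|) ∧
        ∀ B ν : ℝ, 0 < ν → (1 + ε₀) * ν ^ 2 < 1 → ∀ J : ℤ,
          ∃ (j : ℤ) (t : ℝ), J ≤ j ∧ 0 ≤ t ∧ t < T ∧ B * ν ^ j < ‖shellVec X j t‖ := by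
  obtain ⟨κ, hκ, H⟩ := maximalViscousFlow_of_noGlobalCascade hε hα hNG
  refine ⟨κ, hκ, fun visc hvisc hvk => ?_⟩
  obtain ⟨T, X, hT, h1, h2, h3, h4, h5, h6⟩ := H visc hvisc.le hvk
  refine ⟨T, X, hT, h1, h2, h3, h4, h5, h6, fun B ν hν hsub J => ?_⟩
  -- the energy bound `‖x_k(t)‖ ≤ √m ‖X₀‖` along the viscous flow
  have hder : ∀ i k, ∀ τ ∈ Ico (0 : ℝ) T, HasDerivWithinAt (X i k)
      (quadTerm ε₀ α X i k τ - visc * (1 + ε₀) ^ ((2 : ℝ) * k) * X i k τ) (Ici 0) τ := by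
    intro i k τ hτ
    have hd : DifferentiableWithinAt ℝ (X i k) (Ico 0 T) τ :=
      ((h1 i k).differentiableOn one_ne_zero) τ hτ
    have hd' : DifferentiableWithinAt ℝ (X i k) (Ici 0) τ :=
      hd.mono_of_mem_nhdsWithin (by
        rw [mem_nhdsWithin]
        exact ⟨Iio T, isOpen_Iio, hτ.2, fun x hx => ⟨hx.2, hx.1⟩⟩)
    rw [← h4 i k τ hτ.1 hτ.2]
    exact hd'.hasDerivWithinAt
  have hreg : ∀ T' : ℝ, T' < T → ∃ M : ℝ, ∀ τ ∈ Icc (0 : ℝ) T', ∀ (i : Fin m) (k : ℤ),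
      (1 + (1 + ε₀) ^ ((10 : ℝ) * k)) * |X i k τ| ≤ M := by
    intro T' hT'
    rcases le_or_gt T' 0 with h0 | h0
    · obtain ⟨M, hM⟩ := h5 (T / 2) (by linarith) (by linarith)
      exact ⟨M, fun τ hτ i k => hM τ hτ.1 (by linarith [hτ.2]) i k⟩
    · obtain ⟨M, hM⟩ := h5 T' h0 hT'
      exact ⟨M, fun τ hτ i k => hM τ hτ.1 hτ.2 i k⟩
  have hamp := viscous_abs_le_datumNorm hε hvisc.le hα.2.1 hder h2 h3 hreg
  set D : ℝ := Real.sqrt m * Real.sqrt (∑ j, X₀ j ^ 2) with hD_def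
  have hD0 : 0 ≤ D := by positivity
  have hD : ∀ (k : ℤ), ∀ t ∈ Ico (0 : ℝ) T, ‖shellVec X k t‖ ≤ D := fun k t ht =>
    DSSOneShift.norm_shellVec_le_sqrt_mul (Real.sqrt_nonneg _) (fun i => hamp t ht i k)
  have hν1 : ν ≤ 1 := by
    by_contra h; push Not at h
    nlinarith [one_lt_pow₀ h (two_ne_zero)]
  -- if no shell `≥ J` broke the envelope, an enlarged envelope would hold on ALL shells
  by_contra hcon
  push Not at hcon
  have hνJ : 0 < ν ^ J := zpow_pos hν J
  set B' : ℝ := max B (D / ν ^ J) with hB'_def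
  have hceil : ∀ (j : ℤ) (t : ℝ), 0 ≤ t → t < T → ‖shellVec X j t‖ ≤ B' * ν ^ j := by
    intro j t ht htT
    rcases le_or_gt J j with hj | hj
    · exact (hcon j t hj ht htT).trans (mul_le_mul_of_nonneg_right (le_max_left _ _) (zpow_nonneg hν.le _))
    · calc ‖shellVec X j t‖ ≤ D := hD j t ⟨ht, htT⟩
        _ = (D / ν ^ J) * ν ^ J := by field_simp
        _ ≤ (D / ν ^ J) * ν ^ j :=
            mul_le_mul_of_nonneg_left (zpow_le_zpow_right_of_le_one₀ hν hν1 hj.le) (by positivity)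
        _ ≤ B' * ν ^ j := mul_le_mul_of_nonneg_right (le_max_right _ _) (zpow_nonneg hν.le _)
  obtain ⟨M, hM⟩ := weight45_bounded_of_subcriticalCeiling hε hvisc hα.2.1 h1 h2 h3 h4 hν hsub hceil
  obtain ⟨t, ht0, htT, i, n, hlt⟩ := h6 M
  exact absurd (hM t ht0 htT i n) (not_le.2 hlt)

/-- **ROBUST BLOW-UP ⇒ EVERY RENORMALISED VISCOUS COMPANION IS (S_a)-SURVIVING FORWARD FOR EVERY `a > 1`.**
If `NoGlobalCascade ε₀ α X₀` (`ε₀ > 0`, `α ∈ E₂(R)`, any `m`), there is `κ > 0` such that for every viscosity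
`0 < ν̂ ≤ κ/√2` the maximal `ν̂`-viscous flow `X` on `[0,T)` from the one-shell datum (datum, no shells below `0`, viscous
motion, (4.5) norm unbounded) has a renormalisation `W_n(σ) = Λ^n e^{-σ} x_n(T - e^{-σ})` with `EternalSurvivingFwd a ε₀ W`
for EVERY exponent `a > 1`: some fixed level (`c = 1`) of `physWeight(a)^n e^{2σ}‖W_n(σ)‖² = (1+ε₀)^{an}‖x_n(t)‖²` is
reached on arbitrarily high shells at arbitrarily late log-times. The registered stub of item 20206 asks this at `a = 1`
for an inviscid two-sided `IsEternal` ω-limit; the lineage had `a = 5` for the exact flow (`eternalSurvivingFwd_five_of_noGlobalCascade`).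
[cite: Tao2016AveragedNS, §4 Thm. 4.2, the viscous equation before Thm. 4.2, §6.4; Teschl2012, §2.6 Cor. 2.16; cell vocabulary (`EternalSurvivingFwd`)] -/
theorem eternalSurvivingFwd_viscous_of_one_lt {ε₀ R : ℝ} (hε : 0 < ε₀)
    {α : Fin m → Fin m → Fin m → ℤ × ℤ × ℤ → ℝ} {X₀ : Fin m → ℝ} (hα : InTableClass R α)
    (hNG : NoGlobalCascade ε₀ α X₀) :
    ∃ κ : ℝ, 0 < κ ∧ ∀ visc : ℝ, 0 < visc → visc * Real.sqrt 2 ≤ κ →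
      ∃ (T : ℝ) (X : Fin m → ℤ → ℝ → ℝ), 0 < T ∧
        (∀ i n, ContDiffOn ℝ 1 (X i n) (Set.Ico 0 T)) ∧
        (∀ i n, X i n 0 = if n = 0 then X₀ i else 0) ∧
        (∀ i n t, n < 0 → X i n t = 0) ∧
        (∀ i n t, 0 ≤ t → t < T → derivWithin (X i n) (Set.Ici 0) t =
          quadTerm ε₀ α X i n t - visc * (1 + ε₀) ^ ((2 : ℝ) * n) * X i n t) ∧
        (∀ M : ℝ, ∃ t : ℝ, 0 ≤ t ∧ t < T ∧
          ∃ (i : Fin m) (n : ℤ), M < (1 + (1 + ε₀) ^ ((10 : ℝ) * n)) * |X i n t|) ∧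
        ∀ W : ℤ → ℝ → Em m,
          (∀ n σ, W n σ = (bigLam ε₀ ^ n * Real.exp (-σ)) • shellVec X n (T - Real.exp (-σ))) →
          ∀ a : ℝ, 1 < a → EternalSurvivingFwd a ε₀ W := by
  obtain ⟨κ, hκ, H⟩ := viscousFloors_of_noGlobalCascade hε hα hNG
  refine ⟨κ, hκ, fun visc hvisc hvk => ?_⟩
  obtain ⟨T, X, hT, h1, h2, h3, h4, h5, h6, hfl⟩ := H visc hvisc hvk
  refine ⟨T, X, hT, h1, h2, h3, h4, h6, fun W hW a ha => ?_⟩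
  have hb : (0 : ℝ) < 1 + ε₀ := by linarith
  have hb1 : (1 : ℝ) < 1 + ε₀ := by linarith
  -- it suffices to treat `a' = min a 2 ∈ (1, 2]` (survival is antitone in the exponent)
  set a' : ℝ := min a 2 with ha'_def
  have ha'1 : 1 < a' := lt_min ha (by norm_num)
  have ha'2 : a' ≤ 2 := min_le_right _ _
  refine EternalSurvivingFwd.mono hε.le ?_ (min_le_left a 2)
  -- weight base `w = (1+ε₀)^{a'}` and rate `ν = w^{-1/2}`: `(1+ε₀) ν² = (1+ε₀)/w < 1`
  set w : ℝ := (1 + ε₀) ^ a' with hw_def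
  have hw0 : 0 < w := Real.rpow_pos_of_pos hb _
  have hw1 : 1 + ε₀ < w := by
    have h := (Real.rpow_lt_rpow_left_iff hb1).2 ha'1
    rwa [Real.rpow_one] at h
  have hw20 : w < (1 + ε₀) ^ 20 := by
    have h2 : w ≤ (1 + ε₀) ^ 2 := by
      rw [← Real.rpow_two]; exact Real.rpow_le_rpow_of_exponent_le hb1.le ha'2
    exact lt_of_le_of_lt h2 (pow_lt_pow_right₀ hb1 (by norm_num))
  set ν : ℝ := Real.sqrt w⁻¹ with hν_def
  have hν : 0 < ν := Real.sqrt_pos.2 (inv_pos.2 hw0)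
  have hνsq : ν ^ 2 = w⁻¹ := Real.sq_sqrt (inv_pos.2 hw0).le
  have hsub : (1 + ε₀) * ν ^ 2 < 1 := by
    rw [hνsq, ← div_eq_mul_inv, div_lt_one hw0]; exact hw1
  refine ⟨1, one_pos, fun N => ?_⟩
  -- early smallness of `w^n ‖x_n‖²` beyond some shell `K` on `[0,T']`, `T' = max (T - e^{-N}) (T/2)`
  set T' : ℝ := max (T - Real.exp (-(N : ℝ))) (T / 2) with hT'_def
  have hT'0 : 0 < T' := lt_of_lt_of_le (by linarith) (le_max_right _ _)
  have hT'T : T' < T := max_lt (by linarith [Real.exp_pos (-(N : ℝ))]) (by linarith)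
  obtain ⟨K, hK⟩ := weightedEnergy_small_early_base hε h5 hT'0 hT'T one_pos hw0.le hw20
  -- a floor above shell `max N K`
  obtain ⟨j, t, hj, ht0, htT, hfloor⟩ := hfl 1 ν hν hsub ((max N K : ℕ) : ℤ)
  obtain ⟨n, rfl⟩ := Int.eq_ofNat_of_zero_le ((by positivity : (0 : ℤ) ≤ ((max N K : ℕ) : ℤ)).trans hj)
  have hn : max N K ≤ n := by exact_mod_cast hj
  rw [one_mul, zpow_natCast] at hfloor
  -- the `w`-weighted energy exceeds `1` there
  have hwt : 1 < w ^ n * ‖shellVec X (n : ℤ) t‖ ^ 2 := by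
    have hp : (ν ^ n) ^ 2 < ‖shellVec X (n : ℤ) t‖ ^ 2 := pow_lt_pow_left₀ hfloor (pow_nonneg hν.le n) two_ne_zero
    have hq : (ν ^ n) ^ 2 = (ν ^ 2) ^ n := by rw [← pow_mul, ← pow_mul, mul_comm]
    have h1 : w ^ n * (ν ^ n) ^ 2 = 1 := by
      rw [hq, hνsq, ← mul_pow, mul_inv_cancel₀ hw0.ne', one_pow]
    calc (1 : ℝ) = w ^ n * (ν ^ n) ^ 2 := h1.symm
      _ < w ^ n * ‖shellVec X (n : ℤ) t‖ ^ 2 := mul_lt_mul_of_pos_left hp (pow_pos hw0 n)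
  -- hence the time is late
  have hlate : T' < t := by
    by_contra hle
    push Not at hle
    exact absurd (hK n ((le_max_right N K).trans hn) t ht0 hle) (not_lt.2 hwt.le)
  have hpos : 0 < T - t := by linarith
  refine ⟨n, (le_max_left N K).trans hn, -Real.log (T - t), ?_, ?_⟩
  · have ht1 : T - Real.exp (-(N : ℝ)) ≤ t := (le_max_left _ _).trans hlate.le
    have hlog : Real.log (T - t) ≤ -(N : ℝ) := by
      rw [← Real.log_exp (-(N : ℝ))]
      exact Real.log_le_log hpos (by linarith)
    linarith
  · rw [renormalisedFlow_weightedEnergy_rpow hε hW a' n, neg_neg, Real.exp_log hpos, sub_sub_cancel]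
    exact hwt.le

end BlowupRigidityOne

end Summit.NavierStokesRegularity.NavierStokesRegularity.Theorems

end
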